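import Literature.MathematicalPhysics.QuantumFieldTheory.Balaban1983to89.B7Prop7OneStep

/-!
# `Balaban1983to89.B7Prop7OneStepAnalytic` — T. Bałaban, *Averaging operations for lattice gauge theories*, Commun. Math. Phys. **98**
(1985) 17–51 [Balaban1985Averaging]: PROPOSITION 7 (p. 43), THE ONE-STEP MAP IS «ANALYTIC IN BOTH VARIABLES A′ AND A» — the
covariant averaging objects (58)/(82)/(42)/(65)/(89) and `Q(W, A, c)` (121) for a BACKGROUND THAT VARIES ANALYTICALLY, and the
joint analyticity of `(A″, A) ↦ Q(e^{A″}V₀, A, c)` at a regular `V₀`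

statement-level skeleton of published theorems with citation tags; proofs where landed; nothing here is a claim about the Yang–Mills mass gap

PDF held: `paper:balaban1985-cmp98-averaging` (journal page = PDF page + 16); p. 43 read on the render
`b2b-balaban-ref1/pages/1985-cmp98-averaging/1985-cmp98-averaging-p027-x2.png` (AS AN IMAGE, this unit, 2026-08-21).

CITATION HEADER (lean-in-tree rule).  Cell `lit-balaban` (HOME `run/shared/lean/pub/lit-balaban/`), unit `lit-balaban-r04` (B7 block
owner, gen 4; TAKING line HOME/STATUS.md 2026-08-21T04:30:51Z) — KERNEL PIECES for SKELETON row **`B7.Prop7`**, companion of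
`B7Prop7OneStep` (the domain conditions / (123) at the complex background `U″V₀`).

PRINT (p. 43 [PDF 27]).  «We take U′U₀ instead of U₀, U′ = e^{iηA′}, |A′| < α₁, and we consider the function Q_k(U′U₀, ηA). We want
to prove that it is an analytic function of both variables A′ and A … **Proposition 7.** For U₀ satisfying (52) and U′ = e^{iηA′},
|A′| < α₁, α₀, α₁ sufficiently small, the function Q_k(U′U₀, ηA) is analytic in complex variables A′, A, and Proposition 4 holds
uniformly in A′.»

WHAT THIS FILE PROVES (kernel, no `sorry`, standard axioms; theorems only).  The analyticity chain of `B7Prop3GeneralAnalytic`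
(`analyticAt_hol_mulCfg` … `analyticAt_mlog_dbavgCov_expCfg`, there for the field family `e^{B(t)}` at a FIXED background) redone for
BONDWISE-ANALYTIC UNIT-VALUED FAMILIES in which the BACKGROUND varies too (hypothesis shape: `t ↦ Z(t)(b)` and `t ↦ Z(t)(b)⁻¹` analytic
at `t₀` for every bond; `t` in any complex normed space `E`): `analyticAt_bond_expCfg_family / _mul_family / _const_family`,
`analyticAt_hol_family` (9), `analyticAt_tHol_family` (58), `analyticAt_Fcov_family` / `analyticAt_wframe_family` (82), `analyticAt_Xavg_family` /
`analyticAt_bavg_family` (42), `analyticAt_tild_family` (65), `analyticAt_dbavgCov_family` (89), `analyticAt_Qcov_family` (121) — each under the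
displayed log-domain conditions at `t₀` —, and **`prop7_oneStep_analyticAt`**: for a unit-bounded background `V₀` with regular block loops
at `c`, a bondwise-analytic unit-valued PERTURBATION family `U″(t)` within `u` of `1` at `t₀` and a bondwise-analytic FIELD family `P(t)` with
`(2d+2)L·(sup|P(t₀)| + 2u) ≤ θ ≤ 1/128`, `t ↦ Q(U″(t)·V₀, P(t), c)` is analytic at `t₀` (domain conditions = `B7Prop7OneStep.logDomainCplx_lt`);
`prop7_oneStep_analyticAt_expCfg` (the displayed `U″(t) = e^{B″(t)}`, `(2d+2)L·(a + 4a″) ≤ θ`) and `prop7_oneStep_analyticAt_of_pdev` (print's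
(52) in plaquette currency, `pdev V₀ < β ≤ 1/(2048(d+1)(d+4)L²)`).  With `t = (a″, a) ∈ 𝔸^S × 𝔸^S` and bond insertions this is the JOINT
analyticity of Proposition 7 for ONE step (`k = 1`).
NOT CLAIMED HERE: the `k`-fold composite `Q_k(U′U₀, ·)` (needs the level bounds — sequel `B7Prop7Levels`), Prop. 4 uniformly in `A′`.
REUSED BY NAME: `B7Prop7OneStep.logDomainCplx_lt / norm_bond_expCfg_sub_one_le`, `B7Prop3GeneralAnalytic` (architecture),
`B7Eq92Concrete.tHol / Fcov / wframe / tild_apply / dbavgCov_apply / Rc_apply`, `B7Prop1Explicit.hol / hol_cons / stepHol / Wcx_eq_hol_loop /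
Xavg / bavg / expUnit / exp_sub_one_le_of_le`, `B7Prop3Flat.expCfg / val_bavg`, `B7Prop3GeneralLinear.Qcov`, `B7Eq123General.blockLoops_of_pdev`,
`ExpMeanLog.analyticAt_mlog`, Mathlib `NormedSpace.exp_analytic`.
Unit `lit-balaban-r04` (gen 4), 2026-08-21.

[cite: Balaban1985Averaging, Proposition 7 p.43]
-/

noncomputable section

open scoped BigOperators
open NormedSpace Metric Set Finset

namespace Literature.MathematicalPhysics.QuantumFieldTheory.Balaban1983to89.B7Prop7OneStepAnalytic

open B7Prop1Explicit B7Prop2Explicit B7Prop3Flat B7Eq92Concrete MatrixLog B7Prop3GeneralAnalytic B7Prop3GeneralLinear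
  B7Prop4GeneralLevels B7Eq123General B7Prop7OneStep

-- `Site` alone would resolve to the torus sites of `Setup.lean`; re-export the `ℤ^d` sites of `B7Prop1Explicit`.
export B7Prop1Explicit (Site)

variable {d : ℕ}

/-! ## §1 Bondwise-analytic unit families: the averaging objects with an analytically varying background -/

section Family

variable {𝔸 : Type*} [NormedRing 𝔸] [NormedAlgebra ℂ 𝔸] [CompleteSpace 𝔸]
variable {E : Type*} [NormedAddCommGroup E] [NormedSpace ℂ E]

/-- the bond variables of the small field `V₁ = e^{B(t)}` (109) and their inverses are analytic in `t` for a bondwise-analytic `B`.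
[cite: Balaban1985Averaging, Proposition 7 p.43, (109) p.34] -/
theorem analyticAt_bond_expCfg_family (B : E → Site d → Fin d → 𝔸) {t₀ : E}
    (hB : ∀ x κ, AnalyticAt ℂ (fun t => B t x κ) t₀) (x : Site d) (μ : Fin d) :
    AnalyticAt ℂ (fun t => ((expCfg (B t) x μ : 𝔸ˣ) : 𝔸)) t₀ ∧
      AnalyticAt ℂ (fun t => (((expCfg (B t) x μ)⁻¹ : 𝔸ˣ) : 𝔸)) t₀ := by
  refine ⟨?_, ?_⟩
  · simp only [expCfg, val_expUnit]
    exact (exp_analytic _).fun_comp_of_eq (hB x μ) rfl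
  · simp only [expCfg, val_inv_expUnit, val_expUnit]
    exact (exp_analytic _).fun_comp_of_eq (hB x μ).neg rfl

omit [CompleteSpace 𝔸] in
/-- products of bondwise-analytic unit families — print's `V′V₀`, `U′U₀` — are bondwise-analytic (values and inverses).
[cite: Balaban1985Averaging, Proposition 7 p.43] -/
theorem analyticAt_bond_mul_family {Z Z' : E → Site d → Fin d → 𝔸ˣ} {t₀ : E}
    (hZ : ∀ x μ, AnalyticAt ℂ (fun t => ((Z t x μ : 𝔸ˣ) : 𝔸)) t₀ ∧ AnalyticAt ℂ (fun t => (((Z t x μ)⁻¹ : 𝔸ˣ) : 𝔸)) t₀)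
    (hZ' : ∀ x μ, AnalyticAt ℂ (fun t => ((Z' t x μ : 𝔸ˣ) : 𝔸)) t₀ ∧ AnalyticAt ℂ (fun t => (((Z' t x μ)⁻¹ : 𝔸ˣ) : 𝔸)) t₀)
    (x : Site d) (μ : Fin d) :
    AnalyticAt ℂ (fun t => (((Z t * Z' t) x μ : 𝔸ˣ) : 𝔸)) t₀ ∧
      AnalyticAt ℂ (fun t => ((((Z t * Z' t) x μ)⁻¹ : 𝔸ˣ) : 𝔸)) t₀ := by
  refine ⟨?_, ?_⟩
  · simp only [Pi.mul_apply, Units.val_mul]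
    exact (hZ x μ).1.fun_mul (hZ' x μ).1
  · simp only [Pi.mul_apply, mul_inv_rev, Units.val_mul]
    exact (hZ' x μ).2.fun_mul (hZ x μ).2

omit [CompleteSpace 𝔸] in
/-- a constant configuration (the fixed background `V₀`) is a bondwise-analytic family. [cite: Balaban1985Averaging, Proposition 7 p.43] -/
theorem analyticAt_bond_const_family (V₀ : Site d → Fin d → 𝔸ˣ) (t₀ : E) (x : Site d) (μ : Fin d) :
    AnalyticAt ℂ (fun _ : E => ((V₀ x μ : 𝔸ˣ) : 𝔸)) t₀ ∧ AnalyticAt ℂ (fun _ : E => (((V₀ x μ)⁻¹ : 𝔸ˣ) : 𝔸)) t₀ :=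
  ⟨analyticAt_const, analyticAt_const⟩

omit [CompleteSpace 𝔸] in
/-- one step of the transport (9) of a bondwise-analytic family (and its inverse) is analytic. [folklore] -/
private theorem analyticAt_stepHol_family {Z : E → Site d → Fin d → 𝔸ˣ} {t₀ : E}
    (hZ : ∀ x μ, AnalyticAt ℂ (fun t => ((Z t x μ : 𝔸ˣ) : 𝔸)) t₀ ∧ AnalyticAt ℂ (fun t => (((Z t x μ)⁻¹ : 𝔸ˣ) : 𝔸)) t₀)
    (x : Site d) (l : Letter d) :
    AnalyticAt ℂ (fun t => ((stepHol (Z t) x l : 𝔸ˣ) : 𝔸)) t₀ ∧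
      AnalyticAt ℂ (fun t => (((stepHol (Z t) x l)⁻¹ : 𝔸ˣ) : 𝔸)) t₀ := by
  obtain ⟨μ, b⟩ := l
  cases b
  · obtain ⟨h1, h2⟩ := hZ (x - e μ) μ
    simp only [stepHol_false, inv_inv]
    exact ⟨h2, h1⟩
  · simpa only [stepHol_true] using hZ x μ

omit [CompleteSpace 𝔸] in
/-- **(9)**: the contour holonomies of a bondwise-analytic unit family and their inverses are analytic. [cite: Balaban1985Averaging, (9) p.18] -/
theorem analyticAt_hol_family {Z : E → Site d → Fin d → 𝔸ˣ} {t₀ : E}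
    (hZ : ∀ x μ, AnalyticAt ℂ (fun t => ((Z t x μ : 𝔸ˣ) : 𝔸)) t₀ ∧ AnalyticAt ℂ (fun t => (((Z t x μ)⁻¹ : 𝔸ˣ) : 𝔸)) t₀) :
    ∀ (w : List (Letter d)) (x : Site d),
      AnalyticAt ℂ (fun t => ((hol (Z t) x w : 𝔸ˣ) : 𝔸)) t₀ ∧
        AnalyticAt ℂ (fun t => (((hol (Z t) x w)⁻¹ : 𝔸ˣ) : 𝔸)) t₀
  | [], x => by simp only [hol_nil, inv_one, Units.val_one]; exact ⟨analyticAt_const, analyticAt_const⟩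
  | l :: w, x => by
      obtain ⟨h1, h2⟩ := analyticAt_hol_family hZ w (x + l.vec)
      obtain ⟨s1, s2⟩ := analyticAt_stepHol_family hZ x l
      refine ⟨?_, ?_⟩
      · simp only [hol_cons, Units.val_mul]
        exact s1.fun_mul h1
      · simp only [hol_cons, mul_inv_rev, Units.val_mul]
        exact h2.fun_mul s2

omit [CompleteSpace 𝔸] in
/-- **(58) with BOTH the background and the field varying analytically**: `(R^{W(t)}_{0,y}Y(t))(Γ)` and its inverse are analytic.
[cite: Balaban1985Averaging, Proposition 7 p.43, (58) p.27] -/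
theorem analyticAt_tHol_family {W Y : E → Site d → Fin d → 𝔸ˣ} {t₀ : E}
    (hW : ∀ x μ, AnalyticAt ℂ (fun t => ((W t x μ : 𝔸ˣ) : 𝔸)) t₀ ∧ AnalyticAt ℂ (fun t => (((W t x μ)⁻¹ : 𝔸ˣ) : 𝔸)) t₀)
    (hY : ∀ x μ, AnalyticAt ℂ (fun t => ((Y t x μ : 𝔸ˣ) : 𝔸)) t₀ ∧ AnalyticAt ℂ (fun t => (((Y t x μ)⁻¹ : 𝔸ˣ) : 𝔸)) t₀)
    (y : Site d) (w : List (Letter d)) :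
    AnalyticAt ℂ (fun t => ((tHol (W t) (Y t) y w : 𝔸ˣ) : 𝔸)) t₀ ∧
      AnalyticAt ℂ (fun t => (((tHol (W t) (Y t) y w)⁻¹ : 𝔸ˣ) : 𝔸)) t₀ := by
  have hYW := fun x μ => analyticAt_bond_mul_family hY hW x μ
  obtain ⟨h1, h2⟩ := analyticAt_hol_family hYW w y
  obtain ⟨h3, h4⟩ := analyticAt_hol_family hW w y
  refine ⟨?_, ?_⟩
  · simp only [tHol, Units.val_mul]
    exact h1.fun_mul h4
  · simp only [tHol, mul_inv_rev, inv_inv, Units.val_mul]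
    exact h3.fun_mul h2

/-- the frame exponent (62)/(82) with varying background and field is analytic wherever the twisted tree holonomies at `t₀` lie in the
domain of the series logarithm (21). [cite: Balaban1985Averaging, Proposition 7 p.43, (82) p.30] -/
theorem analyticAt_Fcov_family {W Y : E → Site d → Fin d → 𝔸ˣ} {t₀ : E}
    (hW : ∀ x μ, AnalyticAt ℂ (fun t => ((W t x μ : 𝔸ˣ) : 𝔸)) t₀ ∧ AnalyticAt ℂ (fun t => (((W t x μ)⁻¹ : 𝔸ˣ) : 𝔸)) t₀)
    (hY : ∀ x μ, AnalyticAt ℂ (fun t => ((Y t x μ : 𝔸ˣ) : 𝔸)) t₀ ∧ AnalyticAt ℂ (fun t => (((Y t x μ)⁻¹ : 𝔸ˣ) : 𝔸)) t₀)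
    (L : ℕ) (y : Site d)
    (hT : ∀ r : Fin d → Fin L, ‖((tHol (W t₀) (Y t₀) y (treeWord (boxVec L r)) : 𝔸ˣ) : 𝔸) - 1‖ < 1) :
    AnalyticAt ℂ (fun t => Fcov L (W t) (Y t) y) t₀ := by
  unfold Fcov
  exact Finset.analyticAt_fun_sum _ fun r _ =>
    ((ExpMeanLog.analyticAt_mlog (hT r)).fun_comp_of_eq (analyticAt_tHol_family hW hY y _).1 rfl).fun_const_smul

/-- the block frame (82) `e^{F(y)}` with varying background and field, and its inverse, are analytic (same domain condition).
[cite: Balaban1985Averaging, Proposition 7 p.43, (82) p.30] -/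
theorem analyticAt_wframe_family {W Y : E → Site d → Fin d → 𝔸ˣ} {t₀ : E}
    (hW : ∀ x μ, AnalyticAt ℂ (fun t => ((W t x μ : 𝔸ˣ) : 𝔸)) t₀ ∧ AnalyticAt ℂ (fun t => (((W t x μ)⁻¹ : 𝔸ˣ) : 𝔸)) t₀)
    (hY : ∀ x μ, AnalyticAt ℂ (fun t => ((Y t x μ : 𝔸ˣ) : 𝔸)) t₀ ∧ AnalyticAt ℂ (fun t => (((Y t x μ)⁻¹ : 𝔸ˣ) : 𝔸)) t₀)
    (L : ℕ) (y : Site d)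
    (hT : ∀ r : Fin d → Fin L, ‖((tHol (W t₀) (Y t₀) y (treeWord (boxVec L r)) : 𝔸ˣ) : 𝔸) - 1‖ < 1) :
    AnalyticAt ℂ (fun t => ((wframe L (W t) (Y t) y : 𝔸ˣ) : 𝔸)) t₀ ∧
      AnalyticAt ℂ (fun t => (((wframe L (W t) (Y t) y)⁻¹ : 𝔸ˣ) : 𝔸)) t₀ := by
  refine ⟨?_, ?_⟩
  · simp only [wframe, val_expUnit]
    exact (exp_analytic _).fun_comp_of_eq (analyticAt_Fcov_family hW hY L y hT) rfl
  · simp only [wframe, val_inv_expUnit]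
    exact (exp_analytic _).fun_comp_of_eq (analyticAt_Fcov_family hW hY L y hT).neg rfl

/-- the exponent `X_c` of the one-step average (42) of a bondwise-analytic configuration family is analytic wherever the block loops
at `t₀` lie in the domain of the series logarithm. [cite: Balaban1985Averaging, Proposition 7 p.43, (42) p.23] -/
theorem analyticAt_Xavg_family {Z : E → Site d → Fin d → 𝔸ˣ} {t₀ : E}
    (hZ : ∀ x μ, AnalyticAt ℂ (fun t => ((Z t x μ : 𝔸ˣ) : 𝔸)) t₀ ∧ AnalyticAt ℂ (fun t => (((Z t x μ)⁻¹ : 𝔸ˣ) : 𝔸)) t₀)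
    (L : ℕ) (q : Site d) (κ : Fin d)
    (hWx : ∀ r : Fin d → Fin L, ‖((Wcx L (Z t₀) q κ (boxVec L r) : 𝔸ˣ) : 𝔸) - 1‖ < 1) :
    AnalyticAt ℂ (fun t => Xavg L (Z t) q κ) t₀ := by
  unfold Xavg
  refine Finset.analyticAt_fun_sum _ fun r _ => ?_
  have h := (analyticAt_hol_family hZ (gammaWord L κ (boxVec L r) ++ seg κ (-(L : ℤ))) q).1
  simp only [← Wcx_eq_hol_loop] at h
  exact ((ExpMeanLog.analyticAt_mlog (hWx r)).fun_comp_of_eq h rfl).fun_const_smul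

/-- the one-step average (42) of a bondwise-analytic configuration family, and its inverse, are analytic (same domain condition).
[cite: Balaban1985Averaging, Proposition 7 p.43, (42) p.23] -/
theorem analyticAt_bavg_family {Z : E → Site d → Fin d → 𝔸ˣ} {t₀ : E}
    (hZ : ∀ x μ, AnalyticAt ℂ (fun t => ((Z t x μ : 𝔸ˣ) : 𝔸)) t₀ ∧ AnalyticAt ℂ (fun t => (((Z t x μ)⁻¹ : 𝔸ˣ) : 𝔸)) t₀)
    (L : ℕ) (q : Site d) (κ : Fin d)
    (hWx : ∀ r : Fin d → Fin L, ‖((Wcx L (Z t₀) q κ (boxVec L r) : 𝔸ˣ) : 𝔸) - 1‖ < 1) :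
    AnalyticAt ℂ (fun t => ((bavg L (Z t) q κ : 𝔸ˣ) : 𝔸)) t₀ ∧
      AnalyticAt ℂ (fun t => (((bavg L (Z t) q κ)⁻¹ : 𝔸ˣ) : 𝔸)) t₀ := by
  have hX := analyticAt_Xavg_family hZ L q κ hWx
  obtain ⟨h1, h2⟩ := analyticAt_hol_family hZ (seg κ (L : ℤ)) q
  refine ⟨?_, ?_⟩
  · simp only [val_bavg]
    exact ((exp_analytic _).fun_comp_of_eq hX rfl).fun_mul h1
  · have hv : ∀ t, (((bavg L (Z t) q κ)⁻¹ : 𝔸ˣ) : 𝔸) = (((hol (Z t) q (seg κ L))⁻¹ : 𝔸ˣ) : 𝔸) * exp (-Xavg L (Z t) q κ) :=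
      fun t => by simp only [bavg, mul_inv_rev, val_inv_expUnit, Units.val_mul, val_expUnit]
    simp only [hv]
    exact h2.fun_mul ((exp_analytic _).fun_comp_of_eq hX.neg rfl)

/-- **(65) with varying background and field**: `Ỹ^{W(t)}(t)(c) = \overline{Y(t)W(t)}(c)·\overline{W(t)}(c)⁻¹` and its inverse are
analytic wherever the block loops of `Y(t₀)W(t₀)` and of `W(t₀)` at `c` lie in the domain of the series logarithm.
[cite: Balaban1985Averaging, Proposition 7 p.43, (65) p.29] -/
theorem analyticAt_tild_family {W Y : E → Site d → Fin d → 𝔸ˣ} {t₀ : E}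
    (hW : ∀ x μ, AnalyticAt ℂ (fun t => ((W t x μ : 𝔸ˣ) : 𝔸)) t₀ ∧ AnalyticAt ℂ (fun t => (((W t x μ)⁻¹ : 𝔸ˣ) : 𝔸)) t₀)
    (hY : ∀ x μ, AnalyticAt ℂ (fun t => ((Y t x μ : 𝔸ˣ) : 𝔸)) t₀ ∧ AnalyticAt ℂ (fun t => (((Y t x μ)⁻¹ : 𝔸ˣ) : 𝔸)) t₀)
    (L : ℕ) (q : Site d) (κ : Fin d)
    (hW1 : ∀ r : Fin d → Fin L, ‖((Wcx L (Y t₀ * W t₀) q κ (boxVec L r) : 𝔸ˣ) : 𝔸) - 1‖ < 1)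
    (hW0 : ∀ r : Fin d → Fin L, ‖((Wcx L (W t₀) q κ (boxVec L r) : 𝔸ˣ) : 𝔸) - 1‖ < 1) :
    AnalyticAt ℂ (fun t => ((tild L (W t) (Y t) q κ : 𝔸ˣ) : 𝔸)) t₀ ∧
      AnalyticAt ℂ (fun t => (((tild L (W t) (Y t) q κ)⁻¹ : 𝔸ˣ) : 𝔸)) t₀ := by
  have hYW := fun x μ => analyticAt_bond_mul_family hY hW x μ
  obtain ⟨h1, h2⟩ := analyticAt_bavg_family (Z := fun t => Y t * W t) hYW L q κ hW1
  obtain ⟨h3, h4⟩ := analyticAt_bavg_family hW L q κ hW0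
  refine ⟨?_, ?_⟩
  · simp only [tild_apply, Units.val_mul]
    exact h1.fun_mul h4
  · simp only [tild_apply, mul_inv_rev, Units.val_mul]
    exact h3.fun_mul h2

/-- **(89) with varying background and field**: the double-bar average `Y̿(t)(c)` at the background `W(t)` is analytic wherever the
contour words entering it at `t₀` lie in the domain of the series logarithm. [cite: Balaban1985Averaging, Proposition 7 p.43, (89) p.31] -/
theorem analyticAt_dbavgCov_family {W Y : E → Site d → Fin d → 𝔸ˣ} {t₀ : E}
    (hW : ∀ x μ, AnalyticAt ℂ (fun t => ((W t x μ : 𝔸ˣ) : 𝔸)) t₀ ∧ AnalyticAt ℂ (fun t => (((W t x μ)⁻¹ : 𝔸ˣ) : 𝔸)) t₀)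
    (hY : ∀ x μ, AnalyticAt ℂ (fun t => ((Y t x μ : 𝔸ˣ) : 𝔸)) t₀ ∧ AnalyticAt ℂ (fun t => (((Y t x μ)⁻¹ : 𝔸ˣ) : 𝔸)) t₀)
    (L : ℕ) (q : Site d) (κ : Fin d)
    (hW1 : ∀ r : Fin d → Fin L, ‖((Wcx L (Y t₀ * W t₀) q κ (boxVec L r) : 𝔸ˣ) : 𝔸) - 1‖ < 1)
    (hW0 : ∀ r : Fin d → Fin L, ‖((Wcx L (W t₀) q κ (boxVec L r) : 𝔸ˣ) : 𝔸) - 1‖ < 1)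
    (hT₁ : ∀ r : Fin d → Fin L, ‖((tHol (W t₀) (Y t₀) q (treeWord (boxVec L r)) : 𝔸ˣ) : 𝔸) - 1‖ < 1)
    (hT₂ : ∀ r : Fin d → Fin L,
      ‖((tHol (W t₀) (Y t₀) (q + (L : ℤ) • e κ) (treeWord (boxVec L r)) : 𝔸ˣ) : 𝔸) - 1‖ < 1) :
    AnalyticAt ℂ (fun t => ((dbavgCov L (W t) (Y t) q κ : 𝔸ˣ) : 𝔸)) t₀ := by
  obtain ⟨hb1, hb2⟩ := analyticAt_bavg_family hW L q κ hW0
  simp only [dbavgCov_apply, Rc_apply, Units.val_mul]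
  exact (((analyticAt_wframe_family hW hY L q hT₁).2.fun_mul (analyticAt_tild_family hW hY L q κ hW1 hW0).1).fun_mul
    ((hb1.fun_mul (analyticAt_wframe_family hW hY L _ hT₂).1).fun_mul hb2))

/-- **(121) with varying background**: `Q(W(t), P(t), c) = log W̿₁(c)[e^{P(t)}]` is analytic at `t₀` wherever the contour words
entering (89) at `t₀` and `W̿₁(c)` itself lie in the domain of the series logarithm. [cite: Balaban1985Averaging, Proposition 7 p.43, (121) p.36] -/
theorem analyticAt_Qcov_family {W : E → Site d → Fin d → 𝔸ˣ} (P : E → Site d → Fin d → 𝔸) {t₀ : E}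
    (hW : ∀ x μ, AnalyticAt ℂ (fun t => ((W t x μ : 𝔸ˣ) : 𝔸)) t₀ ∧ AnalyticAt ℂ (fun t => (((W t x μ)⁻¹ : 𝔸ˣ) : 𝔸)) t₀)
    (hP : ∀ x κ, AnalyticAt ℂ (fun t => P t x κ) t₀) (L : ℕ) (q : Site d) (κ : Fin d)
    (hW1 : ∀ r : Fin d → Fin L, ‖((Wcx L (expCfg (P t₀) * W t₀) q κ (boxVec L r) : 𝔸ˣ) : 𝔸) - 1‖ < 1)
    (hW0 : ∀ r : Fin d → Fin L, ‖((Wcx L (W t₀) q κ (boxVec L r) : 𝔸ˣ) : 𝔸) - 1‖ < 1)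
    (hT₁ : ∀ r : Fin d → Fin L, ‖((tHol (W t₀) (expCfg (P t₀)) q (treeWord (boxVec L r)) : 𝔸ˣ) : 𝔸) - 1‖ < 1)
    (hT₂ : ∀ r : Fin d → Fin L,
      ‖((tHol (W t₀) (expCfg (P t₀)) (q + (L : ℤ) • e κ) (treeWord (boxVec L r)) : 𝔸ˣ) : 𝔸) - 1‖ < 1)
    (hD : ‖((dbavgCov L (W t₀) (expCfg (P t₀)) q κ : 𝔸ˣ) : 𝔸) - 1‖ < 1) :
    AnalyticAt ℂ (fun t => Qcov L (W t) (P t) q κ) t₀ := by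
  unfold Qcov
  exact (ExpMeanLog.analyticAt_mlog hD).fun_comp_of_eq
    (analyticAt_dbavgCov_family hW (analyticAt_bond_expCfg_family P hP) L q κ hW1 hW0 hT₁ hT₂) rfl

end Family

/-! ## §2 The jointly analytic one-step map at the complex background -/

section OneStepJoint

variable {𝔸 : Type*} [NormedRing 𝔸] [NormedAlgebra ℂ 𝔸] [CompleteSpace 𝔸] [NormOneClass 𝔸]
variable {E : Type*} [NormedAddCommGroup E] [NormedSpace ℂ E]

/-- **PROPOSITION 7 FOR ONE STEP — «Q(U′U₀, ηA) … is an analytic function of both variables A′ and A»**: for a unit-bounded background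
`V₀` with block loops at `c = (q, κ)` within `α ≤ 1/128` of `1`, a bondwise-analytic unit-valued PERTURBATION FAMILY `U″(t)` (values and
inverses analytic; e.g. `U″(t) = e^{B″(t)}`) within `u` of `1` at `t₀`, and a bondwise-analytic FIELD FAMILY `P(t)` with
`(2d+2)L·(sup_b|P(t₀)_b| + 2u) ≤ θ ≤ 1/128`, the one-step map at the complex background, `t ↦ Q(U″(t)·V₀, P(t), c)`, is analytic at
`t₀`.  With `t = (a″, a) ∈ 𝔸^S × 𝔸^S` and the insertions of finitely many bond variables this is the JOINT analyticity of Prop. 7 for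
`k = 1`. [cite: Balaban1985Averaging, Proposition 7 p.43] -/
theorem prop7_oneStep_analyticAt {L : ℕ} (hL : 1 ≤ L) {V₀ : Site d → Fin d → 𝔸ˣ} (hV₀ : ∀ x κ, V₀ x κ ∈ U1 𝔸)
    {U'' : E → Site d → Fin d → 𝔸ˣ} {t₀ : E}
    (hUa : ∀ x μ, AnalyticAt ℂ (fun t => ((U'' t x μ : 𝔸ˣ) : 𝔸)) t₀ ∧ AnalyticAt ℂ (fun t => (((U'' t x μ)⁻¹ : 𝔸ˣ) : 𝔸)) t₀)
    {u : ℝ} (hu : 0 ≤ u)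
    (hU : ∀ x κ, ‖((U'' t₀ x κ : 𝔸ˣ) : 𝔸) - 1‖ ≤ u ∧ ‖(((U'' t₀ x κ)⁻¹ : 𝔸ˣ) : 𝔸) - 1‖ ≤ u)
    (P : E → Site d → Fin d → 𝔸) (hP : ∀ x κ, AnalyticAt ℂ (fun t => P t x κ) t₀)
    {a θ α : ℝ} (ha : 0 ≤ a) (hA : ∀ x κ, ‖P t₀ x κ‖ ≤ a)
    (hθ : ((2 * (d * L) + L + L : ℕ) : ℝ) * (a + 2 * u) ≤ θ) (hθ0 : 0 ≤ θ) (hθ1 : θ ≤ 1 / 128)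
    (q : Site d) (κ : Fin d) (hα1 : α ≤ 1 / 128)
    (hreg : ∀ r : Fin d → Fin L, ‖((Wcx L V₀ q κ (boxVec L r) : 𝔸ˣ) : 𝔸) - 1‖ ≤ α) :
    AnalyticAt ℂ (fun t => Qcov L (U'' t * V₀) (P t) q κ) t₀ := by
  obtain ⟨hW0, hW1, hT₁, hT₂, hD⟩ := logDomainCplx_lt hL hV₀ hu hU (P t₀) ha hA hθ hθ0 hθ1 q κ hα1 hreg
  have hWa : ∀ x μ, AnalyticAt ℂ (fun t => (((U'' t * V₀) x μ : 𝔸ˣ) : 𝔸)) t₀ ∧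
      AnalyticAt ℂ (fun t => ((((U'' t * V₀) x μ)⁻¹ : 𝔸ˣ) : 𝔸)) t₀ :=
    fun x μ => analyticAt_bond_mul_family hUa (analyticAt_bond_const_family V₀ t₀) x μ
  exact analyticAt_Qcov_family (W := fun t => U'' t * V₀) P hWa hP L q κ hW1 hW0 hT₁ hT₂ hD

/-- **the displayed case `U′ = e^{iηA′}`**: for bondwise-analytic families `B″(t)` (background perturbation, `sup_b|B″(t₀)_b| ≤ a″`) and
`P(t)` (field, `sup_b|P(t₀)_b| ≤ a`) with `(2d+2)L·(a + 4a″) ≤ θ ≤ 1/128`, `t ↦ Q(e^{B″(t)}·V₀, P(t), c)` is analytic at `t₀` (regular `V₀`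
as above). [cite: Balaban1985Averaging, Proposition 7 p.43] -/
theorem prop7_oneStep_analyticAt_expCfg {L : ℕ} (hL : 1 ≤ L) {V₀ : Site d → Fin d → 𝔸ˣ} (hV₀ : ∀ x κ, V₀ x κ ∈ U1 𝔸)
    (B'' : E → Site d → Fin d → 𝔸) {t₀ : E} (hB'' : ∀ x κ, AnalyticAt ℂ (fun t => B'' t x κ) t₀)
    (P : E → Site d → Fin d → 𝔸) (hP : ∀ x κ, AnalyticAt ℂ (fun t => P t x κ) t₀)
    {a a'' θ α : ℝ} (ha : 0 ≤ a) (hA : ∀ x κ, ‖P t₀ x κ‖ ≤ a) (ha'' : 0 ≤ a'') (hA'' : ∀ x κ, ‖B'' t₀ x κ‖ ≤ a'')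
    (hθ : ((2 * (d * L) + L + L : ℕ) : ℝ) * (a + 4 * a'') ≤ θ) (hθ0 : 0 ≤ θ) (hθ1 : θ ≤ 1 / 128)
    (q : Site d) (κ : Fin d) (hα1 : α ≤ 1 / 128)
    (hreg : ∀ r : Fin d → Fin L, ‖((Wcx L V₀ q κ (boxVec L r) : 𝔸ˣ) : 𝔸) - 1‖ ≤ α) :
    AnalyticAt ℂ (fun t => Qcov L (expCfg (B'' t) * V₀) (P t) q κ) t₀ := by
  have hn1 : (1 : ℝ) ≤ ((2 * (d * L) + L + L : ℕ) : ℝ) := by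
    have : 1 ≤ 2 * (d * L) + L + L := by omega
    exact_mod_cast this
  -- `a″ ≤ 1/64`, so `e^{a″} − 1 ≤ 2a″`
  have ha1 : a'' ≤ 1 / 64 := by nlinarith
  have hu : Real.exp a'' - 1 ≤ 2 * a'' := exp_sub_one_le_of_le le_rfl ha'' ha1
  have hU : ∀ x κ, ‖((expCfg (B'' t₀) x κ : 𝔸ˣ) : 𝔸) - 1‖ ≤ 2 * a'' ∧
      ‖(((expCfg (B'' t₀) x κ)⁻¹ : 𝔸ˣ) : 𝔸) - 1‖ ≤ 2 * a'' := fun x κ =>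
    ⟨(norm_bond_expCfg_sub_one_le (B'' t₀) hA'' x κ).1.trans hu, (norm_bond_expCfg_sub_one_le (B'' t₀) hA'' x κ).2.trans hu⟩
  refine prop7_oneStep_analyticAt hL hV₀ (U'' := fun t => expCfg (B'' t)) (analyticAt_bond_expCfg_family B'' hB'')
    (u := 2 * a'') (by positivity) hU P hP ha hA (θ := θ) ?_ hθ0 hθ1 q κ hα1 hreg
  refine le_trans (le_of_eq ?_) hθ
  ring

/-- **the displayed case in plaquette currency** — print's hypotheses «U₀ satisfying (52) and U′ = e^{iηA′}, |A′| < α₁, α₀, α₁ sufficiently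
small», for one step: `V₀` unit-bounded with `pdev V₀ < β ≤ 1/(2048(d+1)(d+4)L²)` (via Prop. 1, `B7Eq123General.blockLoops_of_pdev`),
`sup_b|B″(t₀)_b| ≤ a″`, `sup_b|P(t₀)_b| ≤ a` with `(2d+2)L·(a + 4a″) ≤ 1/128` ⟹ `t ↦ Q(e^{B″(t)}V₀, P(t), c)` is analytic at `t₀` at EVERY
`L`-bond `c`. [cite: Balaban1985Averaging, Proposition 7 p.43, (52) p.26] -/
theorem prop7_oneStep_analyticAt_of_pdev {L : ℕ} (hL : 1 ≤ L) {V₀ : Site d → Fin d → 𝔸ˣ} (hV₀ : ∀ x κ, V₀ x κ ∈ U1 𝔸)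
    {β : ℝ} (hβ0 : 0 ≤ β) (hβ : pdev V₀ < β) (hβmax : β ≤ 1 / (2048 * ((d : ℝ) + 1) * ((d : ℝ) + 4) * (L : ℝ) ^ 2))
    (B'' : E → Site d → Fin d → 𝔸) {t₀ : E} (hB'' : ∀ x κ, AnalyticAt ℂ (fun t => B'' t x κ) t₀)
    (P : E → Site d → Fin d → 𝔸) (hP : ∀ x κ, AnalyticAt ℂ (fun t => P t x κ) t₀)
    {a a'' : ℝ} (ha : 0 ≤ a) (hA : ∀ x κ, ‖P t₀ x κ‖ ≤ a) (ha'' : 0 ≤ a'') (hA'' : ∀ x κ, ‖B'' t₀ x κ‖ ≤ a'')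
    (hθ : ((2 * (d * L) + L + L : ℕ) : ℝ) * (a + 4 * a'') ≤ 1 / 128) (q : Site d) (κ : Fin d) :
    AnalyticAt ℂ (fun t => Qcov L (expCfg (B'' t) * V₀) (P t) q κ) t₀ := by
  have hL0 : (0 : ℝ) < L := by exact_mod_cast hL
  have hX : (0 : ℝ) < 2048 * ((d : ℝ) + 1) * ((d : ℝ) + 4) * (L : ℝ) ^ 2 := by positivity
  have hβmax' : β ≤ 1 / (1024 * ((d : ℝ) + 1) * ((d : ℝ) + 4) * (L : ℝ) ^ 2) :=
    hβmax.trans (by gcongr; norm_num)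
  obtain ⟨hreg, -⟩ := blockLoops_of_pdev hL hV₀ hβ0 hβ hβmax' q κ
  have hXβ : 2048 * ((d : ℝ) + 1) * ((d : ℝ) + 4) * (L : ℝ) ^ 2 * β ≤ 1 := by
    have := mul_le_mul_of_nonneg_left hβmax hX.le
    rwa [one_div, mul_inv_cancel₀ hX.ne'] at this
  exact prop7_oneStep_analyticAt_expCfg hL hV₀ B'' hB'' P hP ha hA ha'' hA'' hθ (by norm_num) le_rfl q κ
    (α := 16 * ((d : ℝ) + 1) * ((d : ℝ) + 4) * (L : ℝ) ^ 2 * β) (by nlinarith) hreg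

end OneStepJoint

end Literature.MathematicalPhysics.QuantumFieldTheory.Balaban1983to89.B7Prop7OneStepAnalytic

end
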